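import Literature.AlgebraicGeometry.HodgeTheory.WeilClassesFieldSubfieldSubalgebra
import Literature.AlgebraicGeometry.HodgeTheory.MixedEllipticCurvesProductsHodgeClasses
import HarnessLib

/-!
# Weil classes of a SUBFIELD `F = ℚ(S(φ)) ⊆ F′ = ℚ(φ)`, V: «`W_{F′}` consists of decomposable Hodge classes ⟹
# `W_F` consists of decomposable Hodge classes» (Moonen–Zarhin 1998, Remark (1)) — on the divisor ring `D`

Layer `Literature/AlgebraicGeometry/HodgeTheory`, theorem-only sequel of `WeilClassesFieldSubfieldSubalgebra` (for a
subfield `F ⊆ F′ ⊂ End⁰(A)` of ANY index, `W_F ⊗ ℂ` lies in every cup-product-closed system of even-degree classes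
`N j ⊆ H^{2j}(A(ℂ); ℂ)` with `N 0 = H⁰` that contains `W_{F′} ⊗ ℂ` — `weilClassesField_le_of_cupProduct_mem_even_of_eq_eval₂`),
read on THE system Moonen–Zarhin's remark is about: van Geemen's subring `D ⊆ B` generated by the divisor classes, whose
complexification in degree `2m` is the tree's carrier `Barriers.HodgeConjecture.divisorClassesSpan A.X A.dim m`
(`= span_ℂ` of the `m`-fold cup products of rational `(1,1)`-classes, «`Dᵖ` is spanned by `[D₁] ∪ [D₂] ∪ … ∪ [D_p]`»,
LNM 1594 §2.4; an exceptional Hodge class is one of `B` not in `D`, §2.5).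

PRINTED STATEMENT.  B. J. J. Moonen – Yu. G. Zarhin, *Weil classes on abelian varieties*, J. reine angew. Math. 496
(1998) 83–92 = arXiv:alg-geom/9612017 (held text `paper:arxiv-alg-geom_9612017`), Introduction (chunk p0001):
«Hodge classes of this kind [in the `ℚ`-subalgebra `D(X)` of `⊕ᵢ H^{2i}(X, ℚ)` generated by the divisor classes] are
called decomposable Hodge classes; non-decomposable Hodge classes are called exceptional classes»; section «In
practice, the condition …», Remark **(1)** (chunk p0004, lines 62–76): «Furthermore, if `F ⊆ F′` then we have the
implication **`W_{F′}` consists of decomposable Hodge classes ⟹ `W_F` consists of decomposable Hodge classes**.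
This is a direct consequence of Criterion (crit2).  It can also be seen more directly, by using that `W_F` is contained
in the vector subspace generated by exterior products of elements of `W_{F′}`.»  (The «more direct» route is the one
formalised: `WeilClassesFieldSubfieldSubalgebra` §1–§3.)

WHAT IS PROVED (theorems only; no definition, no named fact), for `F′ = ℚ(φ)` (`P(φ) = 0`, `P ∈ ℤ[T]` monic irreducible
of degree `e`, `e · 2m = 2 dim A`), `F = ℚ(ψ)`, `ψ = S(φ)` in `End A` (`S ∈ ℤ[T]` arbitrary; `Q(ψ) = 0`, `Q ∈ ℤ[T]` monic
irreducible of degree `e′`, `e′ · 2m′ = 2 dim A`) — a subfield of ANY index `[F′:F] = m′/m`: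
* §1 `divisorClassesSpan_zero_eq_top` — `D⁰ ⊗ ℂ = H⁰(A(ℂ); ℂ)` (`H⁰ = ℂ · 1` as `H•(A(ℂ); ℂ) = ⋀• H¹`; the degree-`0` half
  of the tree's `Milne1999.mem_divisorClassesSpan_of_eq_zero_or_lt`, reproved here to keep the imports of this layer small).
* §2 **`weilClassesField_le_divisorClassesSpan_of_eq_eval₂_of_irreducible`** — MOONEN–ZARHIN'S REMARK (1) AS PRINTED:
  `weilClassesField A φ P (2m) ⊆ divisorClassesSpan A.X A.dim m ⟹ weilClassesField A ψ Q (2m′) ⊆ divisorClassesSpan A.X A.dim m′`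
  (`W_{F′} ⊗ ℂ ⊆ Dᵐ ⊗ ℂ ⟹ W_F ⊗ ℂ ⊆ D^{m′} ⊗ ℂ`; the divisor ring is closed under cup products,
  `cupProduct_mem_divisorClassesSpan_of_mem`, and `D⁰ ⊗ ℂ = H⁰`); the contrapositive
  **`exists_not_mem_divisorClassesSpan_of_eq_eval₂_of_irreducible`** — if `W_F ⊗ ℂ` has a class outside `D ⊗ ℂ` then so
  has `W_{F′} ⊗ ℂ` (exceptional Weil classes for a subfield force exceptional Weil classes for every overfield
  `F′ = ℚ(φ) ⊇ F` inside `End⁰(A)`).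
* §3 `forall_isOfHodgeType_weilClassesField_of_le_divisorClassesSpan_of_eq_eval₂` — in particular `W_F ⊗ ℂ` then
  consists of Hodge classes of type `(m′, m′)` (`Dᵐ ⊗ ℂ ⊆ H^{m,m}`, `isOfHodgeType_of_mem_divisorClassesSpan`), the first
  display of Remark (1) in the decomposable case (the general Hodge case is `WeilClassesFieldSubfield`
  `forall_isOfHodgeType_weilClassesField_of_eq_eval₂`, by multiplicities).

Not treated here: Criterion (crit2) itself (when the Weil classes are decomposable, in terms of the Albert type of
`X ∼ Y^m` and the map `θ`); the converse of Remark (1) for `F′ ⊇ E`.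

No `sorry`; axioms `propext`, `Classical.choice`, `Quot.sound`.

## References
* [MoonenZarhin1998WeilClasses] B. J. J. Moonen, Yu. G. Zarhin, *Weil classes on abelian varieties*, J. reine angew.
  Math. 496 (1998) 83–92 = arXiv:alg-geom/9612017: Introduction (decomposable / exceptional classes; chunk p0001) and
  section «In practice…», Remark (1) (chunk p0004).
* [vanGeemen1994HodgeAV] B. van Geemen, *An introduction to the Hodge conjecture for abelian varieties*, LNM 1594
  (1994), §2.4 (the subring `D`, `Dᵖ` spanned by products of divisor classes), §2.5 (exceptional classes).
* [Milne1999LefschetzClasses] J. S. Milne, *Lefschetz classes on abelian varieties*, Duke Math. J. 96 (1999), Thm. 3.2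
  (p. 653) (degree `0`: every class is a multiple of `[A]`).
* [HatcherAT2002] A. Hatcher, *Algebraic Topology* (2002), §3.2 Example 3.16 (`H⁰` and the unit), Prop. 3.10.
-/

noncomputable section

open CategoryTheory Polynomial

namespace Literature.AlgebraicGeometry.HodgeTheory

section HodgeTheory

open Literature.AlgebraicTopology.SingularHomology
open Literature.AlgebraicGeometry.Motives (IsSmoothProjective)
open Literature.Barriers.HodgeConjecture (divisorClassesSpan divisorMonomials mem_divisorMonomials_zero)

variable {A : Motives.AbelianVariety ℂ} {φ ψ : A ⟶ A} {P S Q : Polynomial ℤ} {e e' : ℕ}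

/-! ### §1 `D⁰ ⊗ ℂ = H⁰(A(ℂ); ℂ)` -/

section DegreeZero

variable (A) in
/-- **`D⁰ ⊗ ℂ = H⁰`** on a complex abelian variety: `H⁰(A(ℂ); ℂ)` is spanned by the empty cup product `1 = [A]`
(`H•(A(ℂ); ℂ) = ⋀• H¹`, `HasExteriorCohomologyH1.span_range_cupPowOne` in degree `0`), which is the divisor monomial of
degree `0`. (The degree-`0` half of `Milne1999.mem_divisorClassesSpan_of_eq_zero_or_lt`, reproved to keep imports small.)
[cite: Milne1999LefschetzClasses, Thm. 3.2 (p. 653)] [cite: vanGeemen1994HodgeAV, §2.4] [cite: HatcherAT2002, §3.2 Example 3.16] -/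
theorem divisorClassesSpan_zero_eq_top : divisorClassesSpan A.X A.dim 0 = ⊤ := by
  refine eq_top_iff.2 fun x _ => ?_
  have htop : Submodule.span ℂ (Set.range (cupPowOne ℂ (Motives.ComplexPoints A.X) 0)) = ⊤ :=
    (Motives.AbelianVariety.hasExteriorCohomologyH1_complexPoints A).span_range_cupPowOne 0
  have hx : x ∈ Submodule.span ℂ (Set.range (cupPowOne ℂ (Motives.ComplexPoints A.X) 0)) := by
    rw [htop]; exact Submodule.mem_top
  refine Submodule.span_mono ?_ hx
  rintro _ ⟨v, rfl⟩
  exact mem_divisorMonomials_zero.2 (cupPowOne_zero ℂ _ v)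

end DegreeZero

/-! ### §2 Moonen–Zarhin's Remark (1) as printed: `W_{F′} ⊆ D ⟹ W_F ⊆ D` -/

section Decomposable

/-- **MOONEN–ZARHIN 1998, Remark (1): «if `F ⊆ F′` then `W_{F′}` consists of decomposable Hodge classes ⟹ `W_F` consists
of decomposable Hodge classes», on the carriers, for a subfield of ANY index.**  For `F′ = ℚ(φ)` (`P(φ) = 0`, `P ∈ ℤ[T]`
monic irreducible of degree `e`, `e · 2m = 2 dim A`) and `F = ℚ(ψ) ⊆ F′`, `ψ = S(φ)` (`Q(ψ) = 0`, `Q ∈ ℤ[T]` monic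
irreducible of degree `e′`, `e′ · 2m′ = 2 dim A`): if `W_{F′} ⊗ ℂ = weilClassesField A φ P (2m)` lies in the complexified
divisor ring `Dᵐ ⊗ ℂ = divisorClassesSpan A.X A.dim m` (span of `m`-fold cup products of rational `(1,1)`-classes), then
`W_F ⊗ ℂ = weilClassesField A ψ Q (2m′)` lies in `D^{m′} ⊗ ℂ` — «`W_F` is contained in the vector subspace generated by
exterior products of elements of `W_{F′}`» (`weilClassesField_le_of_cupProduct_mem_even_of_eq_eval₂`) and `D ⊗ ℂ` is a
subring with `D⁰ ⊗ ℂ = H⁰` (`cupProduct_mem_divisorClassesSpan_of_mem`, §1).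
[cite: MoonenZarhin1998WeilClasses, Remark (1) (chunk p0004)] [cite: vanGeemen1994HodgeAV, §2.4] -/
theorem weilClassesField_le_divisorClassesSpan_of_eq_eval₂_of_irreducible {m m' : ℕ} (hPm : P.Monic)
    (hPe : P.natDegree = e) (hPirr : Irreducible (P.map (Int.castRingHom ℚ)))
    (hφ : Polynomial.eval₂ (Int.castRingHom (CategoryTheory.End A)) (φ : CategoryTheory.End A) P = 0)
    (her : e * (2 * m) = 2 * A.dim)
    (hψ : (ψ : CategoryTheory.End A) =
      Polynomial.eval₂ (Int.castRingHom (CategoryTheory.End A)) (φ : CategoryTheory.End A) S)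
    (hQm : Q.Monic) (hQe : Q.natDegree = e') (hQirr : Irreducible (Q.map (Int.castRingHom ℚ)))
    (hψQ : Polynomial.eval₂ (Int.castRingHom (CategoryTheory.End A)) (ψ : CategoryTheory.End A) Q = 0)
    (her' : e' * (2 * m') = 2 * A.dim) (hW : weilClassesField A φ P (2 * m) ≤ divisorClassesSpan A.X A.dim m) :
    weilClassesField A ψ Q (2 * m') ≤ divisorClassesSpan A.X A.dim m' :=
  weilClassesField_le_of_cupProduct_mem_even_of_eq_eval₂ (fun j => divisorClassesSpan A.X A.dim j)
    (fun h _ _ ha hb => cupProduct_mem_divisorClassesSpan_of_mem (by omega) h ha hb) (divisorClassesSpan_zero_eq_top A)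
    hPm hPe hPirr hφ her hψ hQm hQe hQirr hψQ her' hW

/-- **Exceptional Weil classes go up**: if `W_F ⊗ ℂ` contains a class outside the complexified divisor ring
(an exceptional class in Moonen–Zarhin's / van Geemen's sense, complexified), then so does `W_{F′} ⊗ ℂ` for every
overfield `F′ = ℚ(φ) ⊇ F = ℚ(S(φ))` inside `End⁰(A)` (contrapositive of Remark (1)).
[cite: MoonenZarhin1998WeilClasses, Introduction (exceptional classes) and Remark (1) (chunks p0001, p0004)]
[cite: vanGeemen1994HodgeAV, §2.5] -/
theorem exists_not_mem_divisorClassesSpan_of_eq_eval₂_of_irreducible {m m' : ℕ} (hPm : P.Monic)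
    (hPe : P.natDegree = e) (hPirr : Irreducible (P.map (Int.castRingHom ℚ)))
    (hφ : Polynomial.eval₂ (Int.castRingHom (CategoryTheory.End A)) (φ : CategoryTheory.End A) P = 0)
    (her : e * (2 * m) = 2 * A.dim)
    (hψ : (ψ : CategoryTheory.End A) =
      Polynomial.eval₂ (Int.castRingHom (CategoryTheory.End A)) (φ : CategoryTheory.End A) S)
    (hQm : Q.Monic) (hQe : Q.natDegree = e') (hQirr : Irreducible (Q.map (Int.castRingHom ℚ)))
    (hψQ : Polynomial.eval₂ (Int.castRingHom (CategoryTheory.End A)) (ψ : CategoryTheory.End A) Q = 0)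
    (her' : e' * (2 * m') = 2 * A.dim)
    (hexc : ∃ c ∈ weilClassesField A ψ Q (2 * m'), c ∉ divisorClassesSpan A.X A.dim m') :
    ∃ c ∈ weilClassesField A φ P (2 * m), c ∉ divisorClassesSpan A.X A.dim m := by
  by_contra hall
  push Not at hall
  obtain ⟨c, hc, hcD⟩ := hexc
  exact hcD (weilClassesField_le_divisorClassesSpan_of_eq_eval₂_of_irreducible hPm hPe hPirr hφ her hψ hQm hQe hQirr
    hψQ her' (fun x hx => hall x hx) hc)

end Decomposable

/-! ### §3 In particular `W_F ⊗ ℂ` then consists of Hodge classes -/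

section Hodge

/-- **`W_{F′} ⊗ ℂ ⊆ D ⊗ ℂ` ⟹ every class of `W_F ⊗ ℂ` is of Hodge type `(m′, m′)`** (Remark (1), first display, in
the decomposable case): `W_F ⊗ ℂ ⊆ D^{m′} ⊗ ℂ ⊆ H^{m′,m′}` (§2 and `isOfHodgeType_of_mem_divisorClassesSpan`).
[cite: MoonenZarhin1998WeilClasses, Remark (1) (chunk p0004)] [cite: vanGeemen1994HodgeAV, §2.4] -/
theorem forall_isOfHodgeType_weilClassesField_of_le_divisorClassesSpan_of_eq_eval₂ {m m' : ℕ} (hPm : P.Monic)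
    (hPe : P.natDegree = e) (hPirr : Irreducible (P.map (Int.castRingHom ℚ)))
    (hφ : Polynomial.eval₂ (Int.castRingHom (CategoryTheory.End A)) (φ : CategoryTheory.End A) P = 0)
    (her : e * (2 * m) = 2 * A.dim)
    (hψ : (ψ : CategoryTheory.End A) =
      Polynomial.eval₂ (Int.castRingHom (CategoryTheory.End A)) (φ : CategoryTheory.End A) S)
    (hQm : Q.Monic) (hQe : Q.natDegree = e') (hQirr : Irreducible (Q.map (Int.castRingHom ℚ)))
    (hψQ : Polynomial.eval₂ (Int.castRingHom (CategoryTheory.End A)) (ψ : CategoryTheory.End A) Q = 0)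
    (her' : e' * (2 * m') = 2 * A.dim) (hW : weilClassesField A φ P (2 * m) ≤ divisorClassesSpan A.X A.dim m) :
    ∀ c ∈ weilClassesField A ψ Q (2 * m'), IsOfHodgeType A.dim A.X (2 * m') m' m' c := fun _ hc =>
  isOfHodgeType_of_mem_divisorClassesSpan (Motives.AbelianVariety.isSmoothProjective_holds (A := A))
    (weilClassesField_le_divisorClassesSpan_of_eq_eval₂_of_irreducible hPm hPe hPirr hφ her hψ hQm hQe hQirr hψQ her' hW hc)

end Hodge

end HodgeTheory

end Literature.AlgebraicGeometry.HodgeTheory
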